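import Mathlib.AlgebraicTopology.FundamentalGroupoid.FundamentalGroup
import Mathlib.GroupTheory.Abelianization.Defs
import Mathlib.Geometry.Manifold.Instances.Sphere
import Mathlib.Geometry.Manifold.SmoothEmbedding
import Mathlib.Geometry.Manifold.Diffeomorph
import Mathlib.Analysis.SpecialFunctions.Trigonometric.Basic
import Mathlib.Analysis.Calculus.Deriv.Basic
import Mathlib.LinearAlgebra.Matrix.Determinant.Basic
import Literature.Topology.FourManifolds.Knots
import Literature.Topology.FourManifolds.ConnectedSum
import HarnessLib

-- provenance: harness21/H21/H21/Prelude/FourManM/DehnSurgery.lean @ a5e76dc (interim HEAD d8f2665); M5 mechanical rewrite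
/-!
# Dehn surgery on framed knots and links (trunk T-4MAN, prelude `FourManM`, outline C15)

This prelude file of the H21 library (trunk `FourManM`; notions `dehn_surgery_framed_link`,
`gluing_along_boundary`; outline `H21/Outlines/FourManM.md` §1 Design 3, (D9), §2 C15 and
review response #2) formalises **integral Dehn surgery** on a framed knot or link in `S³`, in the
*relational* style of `Literature.Topology.FourManifolds.IsOpenGluing` (`Literature.Prelude.FourManM.ConnectedSum`).

* `Literature.Knot.TubularNbhd K`: an **oriented tubular neighbourhood** of a knot `K : 𝕊 1 → 𝕊 3`: a
  smooth embedding `ν : 𝕊 1 × ℝ² → 𝕊 3` with `ν (x, 0) = K x` which is *orientation preserving*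
  (`det_pos`: the frame `(ν, ∂_θ ν, ∂_{w₁} ν, ∂_{w₂} ν)` is positively oriented in `ℝ⁴ ⊇ 𝕊 3`).
* `Literature.Topology.FourManifolds.Knot.TubularNbhd.meridian`, `.longitude`: the meridian loop `θ ↦ ν (x₀, ½ e^{2πiθ})` and
  the push-off (longitude) `θ ↦ ν (e^{2πiθ}, e₀)` of `ν`, loops in the knot complement based
  at `p₀ = ν (x₀, e₀)`, `e₀ = (½, 0)`; `Literature.Knot.TubularNbhd.HasFraming ν m`: the **framing**
  of `ν` is `m : ℤ`, i.e. `[longitude] = m • [meridian]` in `H₁(S³ ∖ K) = π₁(S³ ∖ K)ᵃᵇ ≅ ℤ`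
  (generated by the meridian), i.e. `m` is the linking number of the push-off with `K`.
* `Literature.Topology.FourManifolds.solidTorus`: the open solid torus `D̊² × 𝕊 1 ⊆ ℝ² × 𝕊 1` (an `Opens`, hence a manifold
  modelled on `𝓘(ℝ, ℝ²).prod (𝓡 1)`); `Literature.surgeryRel ν`: the surgery gluing relation between the
  knot complement `S³ ∖ K` and the open solid torus: the point `(t • u, v)` of the punctured solid
  torus (`u ∈ 𝕊 1`, `0 < t < 1`) is identified with `ν (u, t • v)`; so the meridian discs
  `{(t • u, v₀)}` of the new solid torus are glued to the longitudes (push-offs) of `ν`, the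
  radius `t` in the new solid torus corresponding to the radius `t` in `ν` (both tend to `0`
  towards the respective core circles, which are removed).
* `Literature.IsIntegralSurgery IY Y K m`: the manifold `Y` **is (an) `m`-surgery on the knot `K`**:
  `Y` is an open gluing of `S³ ∖ K` and `D̊² × 𝕊 1` along `surgeryRel ν` for some tubular
  neighbourhood `ν` of framing `m`. `Literature.Topology.FourManifolds.IsIntegralSurgeryLink`: the same for a framed link.

## Main statements (named facts `def … : Prop`, D-0014; known results)

* `Literature.Topology.FourManifolds.Knot.nonempty_tubularNbhd`, `Literature.Topology.FourManifolds.Knot.exists_tubularNbhd_hasFraming`,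
  `Literature.Topology.FourManifolds.Knot.TubularNbhd.existsUnique_hasFraming`: tubular neighbourhoods of every framing exist and
  the framing of a tubular neighbourhood is well defined (Rolfsen, *Knots and Links*, §9.F–G;
  Gompf–Stipsicz, *4-manifolds and Kirby calculus*, §4.5, §5.3; Hirsch, *Differential Topology*,
  §4.5).
* `Literature.Topology.FourManifolds.exists_isIntegralSurgery`: `m`-surgery on `K` exists as a closed smooth 3-manifold;
  `Literature.Topology.FourManifolds.nonempty_diffeomorph_of_isIntegralSurgery`: it is unique up to diffeomorphism and depends
  only on the knot type; `Literature.Topology.FourManifolds.isIntegralSurgery_unknot_zero`: `0`-surgery on the unknot is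
  `𝕊 2 × 𝕊 1`; `Literature.Topology.FourManifolds.isIntegralSurgery_unknot_of_natAbs_eq_one`: `±1`-surgery on the unknot is `𝕊 3`
  (Rolfsen §9.G–H; Gompf–Stipsicz §5.3; Lickorish, Ann. of Math. 76 (1962)).

`Literature/` is `sorry`-free (D-0014): these unproved results, and the compactness /
connectedness / isotopy-invariance / link-form lemmas of `IsIntegralSurgery`, are `def … : Prop`
carrying their statements; `IsIntegralSurgery.of_diffeomorph` (proved) takes the `ConnectedSum`
fact `IsOpenGluing.of_diffeomorph` as an explicit hypothesis, and the two unknot statements carry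
`[SphereEmbedding.SmoothnessFacts]` (the `Knots` instance hypothesis under which `unknot` exists).

## Downstream note (M5 migration)

`SurgeryGluck.lean:178` used `isIntegralSurgery_unknot_zero.of_isIsotopic hK.symm` as a proof
term; both are now named facts, so that consumer must take
`(h0 : isIntegralSurgery_unknot_zero) (hiso : IsIntegralSurgery.of_isIsotopic …)` as hypotheses
(or be demoted to a fact). `KirbyMoves`, `KirbyCalculus`, `LinkingNumber` mention the facts in
docstrings only.

## Sources

* D. Rolfsen, *Knots and Links* (1976), Ch. 9, §9.F (surgery on a solid torus), §9.G
  (surgery description of 3-manifolds), §9.H (Kirby moves), §5.D (linking numbers, longitudes).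
* R. Gompf, A. Stipsicz, *4-Manifolds and Kirby Calculus* (1999), §4.5 (framings), §5.3
  (Dehn surgery).
* W. B. R. Lickorish, *A representation of orientable combinatorial 3-manifolds*, Ann. of Math.
  76 (1962), 531–540; A. H. Wallace, Canad. J. Math. 12 (1960).
* M. W. Hirsch, *Differential Topology* (1976), §4.5 (tubular neighbourhoods).

## Mathlib status and design choices

* Mathlib has `Manifold.IsSmoothEmbedding`, the manifold structures on spheres, products and open
  subsets, `FundamentalGroup`, `FundamentalGroup.fromPath`, `Path.Homotopic.Quotient.mk`,
  `Abelianization`; it has **no** tubular neighbourhoods, framings, solid tori, Dehn surgery or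
  linking numbers (`rg -i 'tubular|Dehn|surgery|solid torus|linking number' Mathlib`: nothing
  relevant). Everything below is therefore new, built on `Literature.Topology.FourManifolds.Knot`, `Literature.Topology.FourManifolds.circlePoint`,
  `Literature.Topology.FourManifolds.SphereEmbedding.complement`, `Literature.Topology.FourManifolds.Link.complement` (`Knots`) and `Literature.Topology.FourManifolds.IsOpenGluing`
  (`ConnectedSum`).
* **Orientation of `ν` (outline D9, review #2).** Without the field `det_pos`, precomposing `ν`
  with `(x, (w₁, w₂)) ↦ (x, (w₁, -w₂))` would reverse the meridian, turning framing `m` into `-m`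
  while producing the same surgered manifold; the framing integer would be undetermined. With it,
  `HasFraming ν m` pins down `m` (`existsUnique_hasFraming`) as the linking number of the push-off
  with `K` for the standard orientation of `S³ = ∂B⁴` (outward normal first), and
  `nonempty_diffeomorph_of_isIntegralSurgery` is true. If the opposite sign convention is
  preferred when comparing with the literature, only `m ↦ -m` changes; the consumers (SPC4 S22,
  S25) are sign-free.
* The framing is expressed through `π₁ᵃᵇ` of the knot complement rather than through singular
  homology or linking numbers (neither knot-complement homology nor linking numbers are available);
  `H₁(S³ ∖ K) ≅ ℤ` generated by the meridian is Alexander duality (Rolfsen §5.D).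
* Loops are based at `p₀ = ν (circlePoint 0, e₀)` with `e₀ = ½ • circlePoint 0 = (½, 0)`, so that
  the endpoint identities of `meridian`/`longitude` reduce to `circlePoint (2π) = circlePoint 0`.
* The pieces of the gluing are `Opens` (`K.complement`, `solidTorus`), which carry Mathlib's
  open-submanifold structure; no quotient type is constructed (outline Design 3). Existence and
  uniqueness of the surgered manifold are theorems.
* Deferred: rational (`p/q`) surgery, knot traces `X_m(K)` (4-manifolds with boundary obtained by
  attaching a 2-handle; wave L), the Lickorish–Wallace theorem and Kirby calculus as statements.
-/

open scoped Manifold ContDiff Topology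
open Function Set

noncomputable section

namespace Literature.Topology.FourManifolds

/-- Local notation: `𝔼 n` is the model Euclidean space `EuclideanSpace ℝ (Fin n)`. -/
local notation "𝔼 " n:arg => EuclideanSpace ℝ (Fin n)

/-- Local notation: `𝕊 n` is the unit sphere in `EuclideanSpace ℝ (Fin (n + 1))`, the standard
`n`-sphere with its Mathlib manifold structure. -/
local notation "𝕊 " n:arg => (Metric.sphere (0 : EuclideanSpace ℝ (Fin (n + 1))) 1)

/-! ### Oriented tubular neighbourhoods -/

/-- An **oriented tubular neighbourhood** of a knot `K : 𝕊 1 → 𝕊 3`: a smooth embedding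
`ν : 𝕊 1 × ℝ² → 𝕊 3` of the (trivial) normal bundle extending `K` along the zero section,
`ν (x, 0) = K x`, and orientation preserving from `𝕊 1 × ℝ²` (product orientation) to
`𝕊 3 = ∂B⁴` (boundary orientation, outward normal first), see `det_pos`. The framing (push-off)
of `ν` is the curve `x ↦ ν (x, e₀)`. Hirsch, *Differential Topology* (1976), §4.5; Rolfsen,
*Knots and Links* (1976), §9.F; Gompf–Stipsicz (1999), §4.5; outline (D9). Since the parameter
is a bare function `𝕊 1 → 𝕊 3` (the coercion of a `Knot`), consumers write `Knot.TubularNbhd K`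
(dot notation `K.TubularNbhd` on `K : Knot` does not resolve). It is a `FunLike`. [cite: GompfStipsicz1999] -/
@[ext]
structure Knot.TubularNbhd (K : 𝕊 1 → 𝕊 3) where
  /-- The embedding `𝕊 1 × ℝ² → 𝕊 3`. -/
  toFun : (𝕊 1) × (𝔼 2) → 𝕊 3
  /-- The map is a `C^∞` embedding. -/
  isSmoothEmbedding : Manifold.IsSmoothEmbedding ((𝓡 1).prod 𝓘(ℝ, 𝔼 2)) (𝓡 3) ∞ toFun
  /-- The zero section is the knot. -/
  apply_zero : ∀ x, toFun (x, 0) = K x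
  /-- **Orientation convention.** At every point the frame
  `(ν, ∂_θ ν, ∂_{w₁} ν, ∂_{w₂} ν)` of `ℝ⁴` — position vector (the outward normal of
  `𝕊 3 = ∂B⁴`) first, then the image of the standard oriented frame of `𝕊 1 × ℝ²` — has positive
  determinant, i.e. `ν` is orientation preserving from `𝕊 1 × ℝ²` (product orientation) to `𝕊 3`
  (boundary orientation, outward normal first). Without this field, precomposing `ν` with
  `(x, (w₁, w₂)) ↦ (x, (w₁, -w₂))` would reverse the meridian and turn framing `m` into `-m` while
  giving the same surgered manifold, so the framing integer would be undetermined; with it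
  `HasFraming ν m` pins down `m` (the linking number of the push-off with `K` for the standard
  orientation of `S³`). If the opposite sign convention is preferred, only `m ↦ -m` changes
  (SPC4 S22 and S25 are sign-free). Outline (D9), review #2. -/
  det_pos : ∀ (θ : ℝ) (w : 𝔼 2), 0 < Matrix.det (Matrix.of
    ![⇑(toFun (circlePoint θ, w) : 𝔼 4),
      ⇑(deriv (fun t : ℝ ↦ (toFun (circlePoint t, w) : 𝔼 4)) θ),
      ⇑(deriv (fun s : ℝ ↦ (toFun (circlePoint θ, w + EuclideanSpace.single 0 s) : 𝔼 4)) 0),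
      ⇑(deriv (fun s : ℝ ↦ (toFun (circlePoint θ, w + EuclideanSpace.single 1 s) : 𝔼 4)) 0)])

/-- **Existence of tubular neighbourhoods.** Every knot has an oriented tubular neighbourhood:
the normal bundle of `K (𝕊 1) ⊆ 𝕊 3` is trivial (an orientable plane bundle over the circle), the
tubular neighbourhood theorem gives an embedding `ν` with `ν (x, 0) = K x`, and since the sign of
the determinant in `det_pos` is locally constant and nonzero for an immersion of connected
`𝕊 1 × ℝ²`, either `ν` or its precomposition with `(x, (w₁, w₂)) ↦ (x, (w₁, -w₂))` satisfies
`det_pos`. Named fact (D-0014). Hirsch, *Differential Topology* (1976), §4.5, Thm 5.2;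
Rolfsen (1976), §9.F. [cite: Hirsch1976, §4.5 Thm 5.2] -/
def Knot.nonempty_tubularNbhd : Prop :=
  ∀ (K : Knot), Nonempty (Knot.TubularNbhd K)

namespace Knot.TubularNbhd

section Function

variable {K : 𝕊 1 → 𝕊 3}

/-- Tubular neighbourhoods are functions `𝕊 1 × ℝ² → 𝕊 3` (pattern of
`Literature.Topology.FourManifolds.SphereEmbedding.instFunLike`). [folklore] -/
instance instFunLike : FunLike (Knot.TubularNbhd K) ((𝕊 1) × (𝔼 2)) (𝕊 3) where
  coe := toFun
  coe_injective _ _ h := TubularNbhd.ext h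

variable (ν : Knot.TubularNbhd K)

/-- The coercion to a function is the field `toFun`. [folklore] -/
@[simp]
theorem toFun_eq_coe : ν.toFun = ⇑ν := rfl

/-- The zero section of a tubular neighbourhood is the knot. [folklore] -/
@[simp]
theorem coe_apply_zero (x : 𝕊 1) : ν (x, 0) = K x := ν.apply_zero x

/-- A tubular neighbourhood is a smooth embedding (coercion form of the field). [folklore] -/
theorem isSmoothEmbedding_coe :
    Manifold.IsSmoothEmbedding ((𝓡 1).prod 𝓘(ℝ, 𝔼 2)) (𝓡 3) ∞ ⇑ν :=
  ν.isSmoothEmbedding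

/-- A tubular neighbourhood is injective. [folklore] -/
protected theorem injective : Injective ν :=
  ν.isSmoothEmbedding.isEmbedding.injective

/-- A tubular neighbourhood is continuous. [folklore] -/
@[continuity, fun_prop]
protected theorem continuous : Continuous ν :=
  ν.isSmoothEmbedding.isEmbedding.continuous

/-- A tubular neighbourhood is `C^∞`. [folklore] -/
protected theorem contMDiff : ContMDiff ((𝓡 1).prod 𝓘(ℝ, 𝔼 2)) (𝓡 3) ∞ ν :=
  ν.isSmoothEmbedding.contMDiff

/-- Off the zero section a tubular neighbourhood misses the knot: `ν (x, w) ∉ K (𝕊 1)` for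
`w ≠ 0` (injectivity of `ν` and `ν (y, 0) = K y`). Hirsch (1976), §4.5. [cite: Hirsch1976] -/
theorem apply_mem_compl_range {x : 𝕊 1} {w : 𝔼 2} (hw : w ≠ 0) :
    ν (x, w) ∈ (range K)ᶜ := by
  rintro ⟨y, hy⟩
  rw [← ν.coe_apply_zero y] at hy
  exact hw (congrArg Prod.snd (ν.injective hy)).symm

/-- The image of a tubular neighbourhood contains the knot. [folklore] -/
theorem range_subset_range : range K ⊆ range ν := by
  rintro _ ⟨x, rfl⟩
  exact ⟨(x, 0), ν.coe_apply_zero x⟩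

end Function

end Knot.TubularNbhd

/-! ### Meridian, longitude and framing -/

/-- Half a unit vector of `ℝ²` is nonzero. [folklore] -/
theorem half_smul_coe_sphere_ne_zero (u : 𝕊 1) : (1 / 2 : ℝ) • (u : 𝔼 2) ≠ 0 :=
  smul_ne_zero (by norm_num) (ne_zero_of_mem_unit_sphere u)

/-- The base vector `e₀ = ½ • (1, 0) = (½, 0)` of `ℝ²` at which the meridian and longitude of a
tubular neighbourhood are based (Rolfsen (1976), §9.F). [cite: Rolfsen1976] -/
def framingBaseVector : 𝔼 2 := (1 / 2 : ℝ) • ((circlePoint 0 : 𝕊 1) : 𝔼 2)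

/-- The base vector `e₀` is nonzero. [folklore] -/
theorem framingBaseVector_ne_zero : framingBaseVector ≠ 0 :=
  half_smul_coe_sphere_ne_zero _

namespace Knot.TubularNbhd

section Framing

variable {K : Knot} (ν : Knot.TubularNbhd K)

/-- The **base point** `p₀ = ν (circlePoint 0, e₀)` of the loops of `ν`, a point of the knot
complement. [folklore] -/
def basePoint : K.complement :=
  ⟨ν (circlePoint 0, framingBaseVector), ν.apply_mem_compl_range framingBaseVector_ne_zero⟩

/-- The base point as a point of `𝕊 3`. [folklore] -/
@[simp]
theorem coe_basePoint : (ν.basePoint : 𝕊 3) = ν (circlePoint 0, framingBaseVector) := rfl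

/-- `circlePoint (2 * π * 0) = circlePoint 0`. [folklore] -/
private theorem circlePoint_two_pi_mul_zero : circlePoint (2 * Real.pi * 0) = circlePoint 0 := by
  rw [mul_zero]

/-- `circlePoint (2 * π * 1) = circlePoint 0`. [folklore] -/
private theorem circlePoint_two_pi_mul_one : circlePoint (2 * Real.pi * 1) = circlePoint 0 := by
  rw [mul_one, ← zero_add (2 * Real.pi), circlePoint_add_two_pi]

/-- The (oriented) **meridian** of the tubular neighbourhood `ν`: the loop
`θ ↦ ν (x₀, ½ e^{2πiθ})`, `x₀ = circlePoint 0`, in the knot complement, based at `p₀`; it bounds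
the meridian disc `ν ({x₀} × ½D²)` meeting `K` once. Its orientation is fixed by `det_pos`.
Rolfsen (1976), §2.E, §9.F; Gompf–Stipsicz (1999), §5.3. [cite: Rolfsen1976] -/
def meridian : Path ν.basePoint ν.basePoint where
  toFun θ := ⟨ν (circlePoint 0, (1 / 2 : ℝ) • (circlePoint (2 * Real.pi * θ) : 𝔼 2)),
    ν.apply_mem_compl_range (half_smul_coe_sphere_ne_zero _)⟩
  continuous_toFun := by
    refine Continuous.subtype_mk ?_ _
    fun_prop
  source' := by
    apply Subtype.ext
    simp only [Set.Icc.coe_zero, coe_basePoint, framingBaseVector, circlePoint_two_pi_mul_zero]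
  target' := by
    apply Subtype.ext
    simp only [Set.Icc.coe_one, coe_basePoint, framingBaseVector, circlePoint_two_pi_mul_one]

/-- The meridian as a map to `𝕊 3`. [folklore] -/
theorem coe_meridian_apply (θ : unitInterval) : (ν.meridian θ : 𝕊 3) =
    ν (circlePoint 0, (1 / 2 : ℝ) • (circlePoint (2 * Real.pi * θ) : 𝔼 2)) := rfl

/-- The **longitude** (push-off, framing curve) of the tubular neighbourhood `ν`: the loop
`θ ↦ ν (e^{2πiθ}, e₀)` in the knot complement, based at `p₀`, parallel to `K`.
Rolfsen (1976), §9.F; Gompf–Stipsicz (1999), §4.5. [cite: Rolfsen1976] -/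
def longitude : Path ν.basePoint ν.basePoint where
  toFun θ := ⟨ν (circlePoint (2 * Real.pi * θ), framingBaseVector),
    ν.apply_mem_compl_range framingBaseVector_ne_zero⟩
  continuous_toFun := by
    refine Continuous.subtype_mk ?_ _
    fun_prop
  source' := by
    apply Subtype.ext
    simp only [Set.Icc.coe_zero, coe_basePoint, circlePoint_two_pi_mul_zero]
  target' := by
    apply Subtype.ext
    simp only [Set.Icc.coe_one, coe_basePoint, circlePoint_two_pi_mul_one]

/-- The longitude as a map to `𝕊 3`. [folklore] -/
theorem coe_longitude_apply (θ : unitInterval) : (ν.longitude θ : 𝕊 3) =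
    ν (circlePoint (2 * Real.pi * θ), framingBaseVector) := rfl

/-- The tubular neighbourhood `ν` **has framing `m`**: in the abelianised fundamental group
`π₁(S³ ∖ K, p₀)ᵃᵇ = H₁(S³ ∖ K; ℤ) ≅ ℤ` (generated by the meridian, Alexander duality) the class of
the longitude (push-off) is `m` times the class of the meridian; equivalently `m` is the linking
number of the push-off with `K`. Rolfsen (1976), §5.D, §9.F–G; Gompf–Stipsicz (1999), §4.5,
§5.3. [cite: Rolfsen1976] -/
def HasFraming (m : ℤ) : Prop :=
  Abelianization.of (FundamentalGroup.fromPath (Path.Homotopic.Quotient.mk ν.longitude)) =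
    Abelianization.of (FundamentalGroup.fromPath (Path.Homotopic.Quotient.mk ν.meridian)) ^ m

/-- **The framing of a tubular neighbourhood is well defined**: there is a unique integer `m` with
`ν.HasFraming m`, because `H₁(S³ ∖ K) ≅ ℤ` is freely generated by the meridian (Alexander
duality) — true thanks to the orientation convention `det_pos`. Rolfsen (1976), §5.D Thm 2,
§9.F; Gompf–Stipsicz (1999), §4.5. Named fact (D-0014). [cite: Rolfsen1976, §5.D Thm 2] -/
def existsUnique_hasFraming : Prop :=
  ∃! m : ℤ, ν.HasFraming m

end Framing

end Knot.TubularNbhd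

/-- **Every framing is realised**: for every knot `K` and integer `m` there is an oriented tubular
neighbourhood of `K` with framing `m` (twist a given one by `(x, w) ↦ (x, R_{kθ(x)} w)` for a
suitable `k : ℤ`). Named fact (D-0014). Rolfsen (1976), §9.F; Gompf–Stipsicz (1999), §4.5. [cite: GompfStipsicz1999, §4.5] -/
def Knot.exists_tubularNbhd_hasFraming : Prop :=
  ∀ (K : Knot) (m : ℤ), ∃ ν : Knot.TubularNbhd K, ν.HasFraming m

/-! ### The open solid torus and the surgery relation -/

/-- The **open solid torus** `D̊² × 𝕊 1 = {(p, v) ∈ ℝ² × 𝕊 1 | ‖p‖ < 1}`, as an open subset of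
`ℝ² × 𝕊 1`; it carries Mathlib's open-submanifold structure for the model
`𝓘(ℝ, ℝ²).prod (𝓡 1)`. Its core circle is `{0} × 𝕊 1` and its meridian discs are `D̊² × {v}`.
Rolfsen (1976), §2.E, §9.F. [cite: Rolfsen1976] -/
def solidTorus : TopologicalSpace.Opens ((𝔼 2) × (𝕊 1)) :=
  ⟨Metric.ball (0 : 𝔼 2) 1 ×ˢ univ, Metric.isOpen_ball.prod isOpen_univ⟩

/-- Membership in the open solid torus. [folklore] -/
@[simp]
theorem mem_solidTorus_iff (p : (𝔼 2) × (𝕊 1)) : p ∈ solidTorus ↔ ‖p.1‖ < 1 := by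
  simp [solidTorus, ← SetLike.mem_coe]

namespace Knot.TubularNbhd

variable {K : 𝕊 1 → 𝕊 3} (ν : Knot.TubularNbhd K)

/-- The **surgery gluing relation** of a tubular neighbourhood `ν`, on ambient points: the point
`(t • u, v)` of `ℝ² × 𝕊 1` (`u ∈ 𝕊 1`, `0 < t < 1`) is related to the point `ν (u, t • v)` of
`𝕊 3`. Thus the punctured meridian discs `{(t • u, v₀)}` of the new solid torus are glued onto the
punctured annuli `{ν (u, t • v₀)}` bounded by the longitudes (push-offs) of `ν`, and the
longitudes `{(t₀ • u₀, v)}` of the new solid torus onto the meridians of `ν`; the radius `t` of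
the new solid torus corresponds to the radius `t` of `ν` (both tend to `0` at the removed core
circles `{0} × 𝕊 1`, resp. `K`). Rolfsen (1976), §9.F; Gompf–Stipsicz (1999), §5.3. [cite: Rolfsen1976] -/
def glueRel (a : 𝕊 3) (b : (𝔼 2) × (𝕊 1)) : Prop :=
  ∃ (u : 𝕊 1) (t : ℝ), t ∈ Ioo (0 : ℝ) 1 ∧ b.1 = t • (u : 𝔼 2) ∧ a = ν (u, t • (b.2 : 𝔼 2))

variable {ν} in
/-- A point of `𝕊 3` related to a point of the solid torus lies off the knot. [folklore] -/
theorem glueRel.mem_compl_range {a : 𝕊 3} {b : (𝔼 2) × (𝕊 1)} (h : ν.glueRel a b) :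
    a ∈ (range K)ᶜ := by
  obtain ⟨u, t, ht, -, rfl⟩ := h
  refine ν.apply_mem_compl_range (smul_ne_zero ht.1.ne' ?_)
  exact ne_zero_of_mem_unit_sphere b.2

variable {ν} in
/-- A point of `ℝ² × 𝕊 1` related to a point of `𝕊 3` lies in the punctured open solid torus. [folklore] -/
theorem glueRel.norm_fst_mem_Ioo {a : 𝕊 3} {b : (𝔼 2) × (𝕊 1)} (h : ν.glueRel a b) :
    ‖b.1‖ ∈ Ioo (0 : ℝ) 1 := by
  obtain ⟨u, t, ht, hb, -⟩ := h
  rw [hb, norm_smul, norm_eq_of_mem_sphere u, mul_one, Real.norm_of_nonneg ht.1.le]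
  exact ht

end Knot.TubularNbhd

/-- The **surgery relation** between the knot complement `S³ ∖ K` and the open solid torus
`D̊² × 𝕊 1` defined by a tubular neighbourhood `ν` of the knot `K`: `a ∼ (t • u, v)` iff
`a = ν (u, t • v)` (`u ∈ 𝕊 1`, `0 < t < 1`), see `Knot.TubularNbhd.glueRel`. Gluing along it
fills the knot exterior `S³ ∖ ν (𝕊 1 × D̊²)` with a solid torus whose meridian is the longitude
(framing curve) of `ν`: integral Dehn surgery. Rolfsen (1976), §9.F; Gompf–Stipsicz (1999),
§5.3. [cite: Rolfsen1976] -/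
def surgeryRel {K : Knot} (ν : Knot.TubularNbhd K) (a : K.complement) (b : solidTorus) : Prop :=
  ν.glueRel (a : 𝕊 3) (b : (𝔼 2) × (𝕊 1))

/-- The **surgery relation for a link**: as `surgeryRel`, between the link complement and the
solid torus glued in at the `i`-th component. Rolfsen (1976), §9.F–G. [cite: Rolfsen1976] -/
def Link.surgeryRel {ι : Type*} [Finite ι] {L : Link ι} (ν : ∀ i, Knot.TubularNbhd (L.component i))
    (i : ι) (a : L.complement) (b : solidTorus) : Prop :=
  (ν i).glueRel (a : 𝕊 3) (b : (𝔼 2) × (𝕊 1))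

/-! ### Integral surgery -/

section Surgery

variable {EY HY : Type*} [NormedAddCommGroup EY] [NormedSpace ℝ EY] [TopologicalSpace HY]
  (IY : ModelWithCorners ℝ EY HY) (Y : Type*) [TopologicalSpace Y] [ChartedSpace HY Y]

/-- **Integral Dehn surgery** (relational form). `IsIntegralSurgery IY Y K m` says that the
manifold `Y` (modelled on `IY`) is the result `S³_m(K)` of `m`-surgery on the knot `K`: for some
oriented tubular neighbourhood `ν` of `K` with framing `m`, `Y` is the open gluing
(`Literature.Topology.FourManifolds.IsOpenGluing`) of the knot complement `S³ ∖ K` and the open solid torus `D̊² × 𝕊 1` along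
`surgeryRel ν`, i.e. `Y = (S³ ∖ ν(𝕊 1 × D̊²)) ∪_{T²} (D² × 𝕊 1)` with the meridian of the new solid
torus glued to the `m`-framed longitude. Rolfsen, *Knots and Links* (1976), §9.F–G;
Gompf–Stipsicz (1999), §5.3; outline C15, Design 3. [cite: GompfStipsicz1999] -/
def IsIntegralSurgery (K : Knot) (m : ℤ) : Prop :=
  ∃ ν : Knot.TubularNbhd K, ν.HasFraming m ∧
    IsOpenGluing (𝓡 3) (𝓘(ℝ, 𝔼 2).prod (𝓡 1)) IY (A := K.complement) (B := solidTorus) (P := Y)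
      (surgeryRel ν)

/-- **Integral Dehn surgery on a framed link** (relational form). `IsIntegralSurgeryLink IY Y L m`
says that `Y` is the result of surgery on the link `L` (finitely many components) with framings
`m i`: there are pairwise disjoint oriented tubular neighbourhoods `ν i` of the components with
framings `m i`, and open smooth embeddings of the link complement `S³ ∖ L` and of one open solid
torus per component into `Y`, with pairwise disjoint solid tori, jointly covering `Y`, the `i`-th
solid torus being glued to the complement along `Link.surgeryRel ν i`. Rolfsen (1976), §9.F–G
(every closed orientable 3-manifold arises this way: Lickorish 1962, Wallace 1960);
Gompf–Stipsicz (1999), §5.3. [cite: Lickorish1962, Wallace 1960] -/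
def IsIntegralSurgeryLink {ι : Type*} [Finite ι] (L : Link ι) (m : ι → ℤ) : Prop :=
  ∃ ν : ∀ i, Knot.TubularNbhd (L.component i), (∀ i, (ν i).HasFraming (m i)) ∧
    (Pairwise fun i j ↦ Disjoint (range (ν i)) (range (ν j))) ∧
    ∃ (jA : L.complement → Y) (jB : ι → solidTorus → Y),
      Manifold.IsSmoothEmbedding (𝓡 3) IY ∞ jA ∧ IsOpen (range jA) ∧
      (∀ i, Manifold.IsSmoothEmbedding (𝓘(ℝ, 𝔼 2).prod (𝓡 1)) IY ∞ (jB i) ∧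
        IsOpen (range (jB i))) ∧
      range jA ∪ (⋃ i, range (jB i)) = univ ∧
      (Pairwise fun i j ↦ Disjoint (range (jB i)) (range (jB j))) ∧
      ∀ i a b, jA a = jB i b ↔ Link.surgeryRel ν i a b

variable {IY Y}

/-- Unfolding of `IsIntegralSurgery`. [folklore] -/
theorem isIntegralSurgery_iff {K : Knot} {m : ℤ} : IsIntegralSurgery IY Y K m ↔
    ∃ ν : Knot.TubularNbhd K, ν.HasFraming m ∧
      IsOpenGluing (𝓡 3) (𝓘(ℝ, 𝔼 2).prod (𝓡 1)) IY (A := K.complement) (B := solidTorus) (P := Y)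
        (surgeryRel ν) :=
  Iff.rfl

/-- A surgered manifold is nonempty: it contains the image of the (nonempty) open solid torus. [folklore] -/
theorem IsIntegralSurgery.nonempty {K : Knot} {m : ℤ} (h : IsIntegralSurgery IY Y K m) :
    Nonempty Y := by
  obtain ⟨-, -, -, jB, -⟩ := h
  exact ⟨jB ⟨(0, circlePoint 0), by simp⟩⟩

/-- **A surgered manifold is compact**: `Y` is the union of the images of the compact sets
`S³ ∖ ν (𝕊 1 × ½D̊²)` and `½D̄² × 𝕊 1`, since a point `ν (u, w)` with `0 < ‖w‖ < ½` is glued to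
`(‖w‖ • u, w / ‖w‖)`. Named fact (D-0014). Rolfsen (1976), §9.F. [cite: Rolfsen1976, §9.F] -/
def IsIntegralSurgery.compactSpace : Prop :=
  ∀ {K : Knot} {m : ℤ} (_h : IsIntegralSurgery IY Y K m), CompactSpace Y

/-- **A surgered manifold is connected**: the knot complement and the solid torus are connected
and their images meet. Named fact (D-0014). Rolfsen (1976), §9.F. [cite: Rolfsen1976, §9.F] -/
def IsIntegralSurgery.connectedSpace : Prop :=
  ∀ {K : Knot} {m : ℤ} (_h : IsIntegralSurgery IY Y K m), ConnectedSpace Y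

/-- **Surgery depends only on the knot type**: if `Y` is `m`-surgery on `K` and `K'` is isotopic
to `K`, then `Y` is `m`-surgery on `K'`: transport `ν` and the gluing map of the complement along
the final diffeomorphism `F 1` of an ambient isotopy (which is orientation preserving, being
isotopic to the identity, so `det_pos` and the framing are preserved). Named fact (D-0014).
Rolfsen (1976), §9.F; Gompf–Stipsicz (1999), §5.3. [cite: Rolfsen1976, §9.F] -/
def IsIntegralSurgery.of_isIsotopic : Prop :=
  ∀ {K K' : Knot} {m : ℤ} (_h : IsIntegralSurgery IY Y K m) (_hK : K.IsIsotopic K'),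
    IsIntegralSurgery IY Y K' m

/-- Surgery is transported along diffeomorphisms of the surgered manifold (Kosinski,
*Differential Manifolds*, VI.1). The `IsManifold` hypotheses are those of
`Literature.Topology.FourManifolds.IsOpenGluing.of_diffeomorph` (a `Diffeomorph` is only `C^∞` for the maximal atlases of
genuine manifolds); both models live on the same vector space `EY`, as there.
Hypothesis: the named fact `hdiff : Literature.IsOpenGluing.of_diffeomorph` of `ConnectedSum`
(transport of open gluings along `e`), for the pieces `S³ ∖ K`, `D̊² × 𝕊 1`. [folklore] -/
theorem IsIntegralSurgery.of_diffeomorph [IsManifold IY ∞ Y] {HY' : Type*} [TopologicalSpace HY']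
    {IY' : ModelWithCorners ℝ EY HY'} {Y' : Type*} [TopologicalSpace Y'] [ChartedSpace HY' Y']
    [IsManifold IY' ∞ Y'] {K : Knot} {m : ℤ}
    (hdiff : IsOpenGluing.of_diffeomorph (IA := 𝓡 3) (IB := 𝓘(ℝ, 𝔼 2).prod (𝓡 1)) (IP := IY)
      (IP' := IY') (A := K.complement) (B := solidTorus) (P := Y) (P' := Y'))
    (h : IsIntegralSurgery IY Y K m) (e : Y ≃ₘ⟮IY, IY'⟯ Y') : IsIntegralSurgery IY' Y' K m := by
  obtain ⟨ν, hν, hG⟩ := h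
  exact ⟨ν, hν, hdiff hG e⟩

/-- **Uniqueness of Dehn surgery.** Two `m`-surgeries `Y`, `Y'` (smooth manifolds, possibly on
different model spaces) on isotopic knots `K`, `K'` are diffeomorphic: an open gluing is
determined up to diffeomorphism by its pieces and relation, any two oriented tubular
neighbourhoods of isotopic knots with the same framing are ambient isotopic (uniqueness of
tubular neighbourhoods, Hirsch §4.5 Thm 5.3, plus `H₁(S³ ∖ K) ≅ ℤ`), and the framing integer is
well defined thanks to `det_pos`. Named fact (D-0014). Rolfsen (1976), §9.F–G; Gompf–Stipsicz
(1999), §5.3. [cite: GompfStipsicz1999, §5.3] -/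
def nonempty_diffeomorph_of_isIntegralSurgery : Prop :=
  ∀ [IsManifold IY ∞ Y]
    {EY' HY' : Type*} [NormedAddCommGroup EY'] [NormedSpace ℝ EY'] [TopologicalSpace HY']
    {IY' : ModelWithCorners ℝ EY' HY'} {Y' : Type*} [TopologicalSpace Y'] [ChartedSpace HY' Y']
    [IsManifold IY' ∞ Y'] {K K' : Knot} {m : ℤ} (_hK : K.IsIsotopic K')
    (_h : IsIntegralSurgery IY Y K m) (_h' : IsIntegralSurgery IY' Y' K' m),
    Nonempty (Y ≃ₘ⟮IY, IY'⟯ Y')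

/-- Surgery on a knot is surgery on the corresponding one-component link (unfold both open-gluing
descriptions; the one-component link complement is the knot complement). Named fact (D-0014).
Gompf–Stipsicz (1999), §5.3; Rolfsen (1976), §9.F–G. [cite: GompfStipsicz1999, §5.3] -/
def IsIntegralSurgery.isIntegralSurgeryLink : Prop :=
  ∀ {K : Knot} {m : ℤ} (_h : IsIntegralSurgery IY Y K m),
    IsIntegralSurgeryLink IY Y (Link.ofKnot K) (fun _ ↦ m)

end Surgery

/-! ### Existence and examples (named facts, known results) -/

/-- **Existence of Dehn surgery.** For every knot `K` and integer `m`, `m`-surgery on `K` exists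
as a closed (compact, Hausdorff, second countable) smooth 3-manifold: choose a tubular
neighbourhood of framing `m` (`Knot.exists_tubularNbhd_hasFraming`) and form the pushout of
`S³ ∖ K` and `D̊² × 𝕊 1` along `surgeryRel ν` (Hausdorff since both core circles are removed).
Named fact (D-0014). Rolfsen, *Knots and Links* (1976), §9.F; Gompf–Stipsicz (1999), §5.3. [cite: GompfStipsicz1999, §5.3] -/
def exists_isIntegralSurgery : Prop :=
  ∀ (K : Knot) (m : ℤ),
    ∃ (Y : Type) (_ : TopologicalSpace Y) (_ : T2Space Y) (_ : SecondCountableTopology Y)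
      (_ : ChartedSpace (𝔼 3) Y) (_ : IsManifold (𝓡 3) ∞ Y) (_ : CompactSpace Y),
      IsIntegralSurgery (𝓡 3) Y K m

/-- **`0`-surgery on the unknot is `𝕊 2 × 𝕊 1`**: the exterior of the unknot is a solid torus
whose meridian is the `0`-framed longitude, and gluing two solid tori meridian-to-meridian gives
`S² × S¹`. Named fact (D-0014); `[SphereEmbedding.SmoothnessFacts]` is the `Knots` instance
hypothesis under which `unknot` is defined. Rolfsen (1976), §9.G Example 3; Gompf–Stipsicz
(1999), §5.3. [cite: Rolfsen1976, §9.G Example 3] -/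
def isIntegralSurgery_unknot_zero [SphereEmbedding.SmoothnessFacts] : Prop :=
  IsIntegralSurgery ((𝓡 2).prod (𝓡 1)) ((𝕊 2) × (𝕊 1)) unknot 0

/-- **`±1`-surgery on the unknot is `𝕊 3`** (gluing two solid tori with meridian glued to a
`(1, ±1)`-curve gives `S³`; the basis of the blow-down Kirby move). Sign-free. Rolfsen (1976),
§9.G Example 4, §9.H; Gompf–Stipsicz (1999), §5.3, Prop. 5.3.1 ff. Named fact (D-0014);
`[SphereEmbedding.SmoothnessFacts]` as for `isIntegralSurgery_unknot_zero`. [cite: Rolfsen1976, §9.G Example 4] -/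
def isIntegralSurgery_unknot_of_natAbs_eq_one [SphereEmbedding.SmoothnessFacts] : Prop :=
  ∀ (m : ℤ) (_hm : m.natAbs = 1), IsIntegralSurgery (𝓡 3) (𝕊 3) unknot m

end Literature.Topology.FourManifolds
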